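import Mathlib
import Literature.Combinatorics.Enumerative.AperyLucasCongruences
import HarnessLib

/-!
# `p`-Lucas congruences for multivariate products of binomial coefficients and their specialisations
(Adamczewski–Bell–Delaygue 2019, Delaygue 2018)

Topic `Literature/Combinatorics/Enumerative`.  Everything in this file is PROVED (no named facts).

## Sources, as printed

B. Adamczewski, J. P. Bell, É. Delaygue, *Algebraic independence of `G`-functions and congruences "à la
Lucas"*, Ann. Sci. Éc. Norm. Supér. (4) **52** (2019) 515–559 [AdamczewskiBellDelaygue2019] (held texts
`paper:arxiv-1603.04187`, `paper:doi-10-24033-asens-2392`; numbering identical), and É. Delaygue,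
*Arithmetic properties of Apéry-like numbers*, Compositio Math. **154** (2018) 249–274 [Delaygue2018]
(held text `paper:arxiv-1310.4131`).

* [AdamczewskiBellDelaygue2019, Def. 3.8] «the family `(a(𝐧))_{𝐧 ∈ ℕ^d}` … satisfies the `p`-Lucas property
  … if `a(𝐯 + 𝐦p) ≡ a(𝐯)a(𝐦) mod p` for all `𝐯` in `{0,…,p−1}^d` and `𝐦` in `ℕ^d`.»
* [AdamczewskiBellDelaygue2019, §8.3] for tuples `e = (𝐞_1,…,𝐞_u)`, `f = (𝐟_1,…,𝐟_v)` of vectors of `ℕ^d`: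
  `Q_{e,f}(𝐧) := ∏ (𝐞_i·𝐧)! / ∏ (𝐟_i·𝐧)!`, the Landau function `Δ_{e,f}(𝐱) := Σ ⌊𝐞_i·𝐱⌋ − Σ ⌊𝐟_j·𝐱⌋` and
  `𝒟_{e,f} := {𝐱 ∈ [0,1)^d : 𝐝·𝐱 ≥ 1 for some 𝐝 among the 𝐞_i, 𝐟_j}`.
  **Prop. 8.7** (= Prop. 7.1 for factorial ratios): «Let us assume that `|e| = |f|` and that `Δ_{e,f}(𝐱) ≥ 1`
  for all `𝐱` in `𝒟_{e,f}`.  Then … `F_{e,f}(𝐱)` satisfies the `p`-Lucas property for all primes `p`.»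
  («This result is also proved by Delaygue in [Delaygue3]» = [Delaygue2018, Thm 3], which adds the converse:
  if `|e| ≠ |f|` or `Δ_{e,f}` vanishes somewhere on `𝒟_{e,f}`, the `p`-Lucas property holds for finitely many
  `p` only.)
* [AdamczewskiBellDelaygue2019, Prop. 7.4] (specialisation): with
  `𝒩 := {𝐧 ∈ ℕ^d : ∀ 𝐱 ∈ [0,1)^d, 𝐧·𝐱 ≥ 1 ⇒ ξ_1(𝐱) ≥ 1}`, `𝐧 ∈ 𝒩` and `b_1,…,b_d ∈ ℚ^×`, the one-variable
  series `F(b_1x^{n_1},…,b_dx^{n_d})` has the `p`-Lucas property for every `p` with all `b_i ∈ ℤ_(p)` (proof,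
  p. 25 of the arXiv text: the terms with `𝐧·𝐚 ≥ p` vanish mod `p`, and `b_i^p ≡ b_i`).  Their §8.3.1 table
  obtains in this way the Lucas congruences of both Apéry sequences («yet another proof of Gessel's result»),
  the Franel, Domb and central Delannoy numbers, and the closing example of §8.3.1 uses the signed
  specialisation `(−x, x)`.

## What is formalised (special case; everything PROVED)

We treat the factorial ratios OF BINOMIAL TYPE, `Q(𝐧) = ∏_j C((𝐮_j + 𝐰_j)·𝐧, 𝐮_j·𝐧)` (i.e. `e = (𝐮_j + 𝐰_j)_j`,
`f = (𝐮_j)_j ⊔ (𝐰_j)_j`, automatically `|e| = |f|`), which covers every entry of the §8.3.1 table and the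
multisums of binomial coefficients the paper is aimed at, and we state the two hypotheses prime by prime in
their first-digit (Kummer) form: for digits `𝐯 ∈ {0,…,p−1}^d`, `Δ_{e,f}(𝐯/p) = #{j : adding 𝐮_j·𝐯 and 𝐰_j·𝐯
in base p carries out of the units digit}`, so «`Δ_{e,f} ≥ 1` on `𝒟_{e,f}`» evaluated at `𝐱 = 𝐯/p` is
`CarryHyp` below, and «`(1,…,1) ∈ 𝒩`» evaluated at `𝐯/p` is `SumCarryHyp`.

* `dot`, `binomProd u w` (= `Q`), `HasLucasProperty a p` (Def. 3.8 with `k = 1`, `R = ℤ`), `CarryHyp`,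
  `SumCarryHyp`, `spec b a N = Σ_{|𝐧| = N} 𝐛^𝐧 a(𝐧)` (the `N`-th coefficient of `F(b_1x,…,b_dx)`).
* `cast_choose_add_of_lt` (Lucas' one-digit step for `C(a+b, a)`), `cast_choose_eq_zero_of_carry` (a carry in
  the units digit kills `C(a+b, a)` mod `p`).
* **`hasLucasProperty_binomProd`** — Prop. 8.7 / [Delaygue2018, Thm 3 (first case)] for binomial type:
  `CarryHyp u w p → HasLucasProperty (binomProd u w) p`.
* **`spec_modEq_mul`** — Prop. 7.4 with `𝐧 = (1,…,1)`, for ANY family `a` with the `p`-Lucas property whose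
  digit values vanish mod `p` when the digit sum is `≥ p`, and integer weights `b`:
  `spec b a (n₀ + pN) ≡ spec b a n₀ · spec b a N (mod p)` for `n₀ < p`;
  **`spec_binomProd_modEq_mul`** — the two combined.

TODO(general form): arbitrary factorial ratios / hypergeometric `F_{𝐮,𝐯}` with parameters in `(0,1]`
(Props. 7.1–7.2, `p^k`-Lucas on residue classes), general exponent vectors `𝐧 ∈ 𝒩` in Prop. 7.4, and the
real-variable Landau formulation quantifying over `[0,1)^d` (equivalent to `∀ p, CarryHyp … p` by taking
`𝐱 = 𝐯/p`).  Nearest existing declarations (used, not restated): `AperyLucasCongruences.cast_choose_digit`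
(Lucas' theorem for one digit, from Mathlib's `Choose.choose_modEq_choose_mod_mul_choose_div_nat`),
`AperyLucasCongruences.genApery_modEq_mul` (the single sums `Σ_k C(n,k)^r C(n+k,k)^s`, Gessel 1982).
-/

namespace Literature.Combinatorics.Enumerative.BinomialProductLucas

open Finset

variable {d r : ℕ}

/-! ## Linear forms, binomial products, the `p`-Lucas property -/

/-- `𝐰·𝐧 = Σ_i w_i n_i`. [cite: AdamczewskiBellDelaygue2019, §8.3 (notation `𝐞_i·𝐧`)] -/
def dot (w n : Fin d → ℕ) : ℕ := ∑ i, w i * n i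

/-- `𝐰·(𝐧 + 𝐦) = 𝐰·𝐧 + 𝐰·𝐦`. [cite: AdamczewskiBellDelaygue2019, §8.3] -/
theorem dot_add (w n m : Fin d → ℕ) : dot w (n + m) = dot w n + dot w m := by
  simp only [dot, Pi.add_apply, mul_add, sum_add_distrib]

/-- `𝐰·(c𝐦) = c (𝐰·𝐦)`. [cite: AdamczewskiBellDelaygue2019, §8.3] -/
theorem dot_smul (w m : Fin d → ℕ) (c : ℕ) : dot w (c • m) = c * dot w m := by
  simp only [dot, Pi.smul_apply, smul_eq_mul, mul_sum]
  exact sum_congr rfl fun i _ => by ring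

/-- The factorial ratio of binomial type `Q(𝐧) = ∏_j C((𝐮_j + 𝐰_j)·𝐧, 𝐮_j·𝐧)` (`e = (𝐮_j+𝐰_j)_j`,
`f = (𝐮_j)_j ⊔ (𝐰_j)_j`, so `|e| = |f|`). [cite: AdamczewskiBellDelaygue2019, §8.3 (`Q_{e,f}`), §8.3.1 (table)] -/
def binomProd (u w : Fin r → Fin d → ℕ) (n : Fin d → ℕ) : ℕ :=
  ∏ j, (dot (u j) n + dot (w j) n).choose (dot (u j) n)

/-- The `p`-Lucas property of a `d`-variate family: `a(𝐯 + p𝐦) ≡ a(𝐯) a(𝐦) (mod p)` for all digit vectors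
`𝐯 ∈ {0,…,p−1}^d` and all `𝐦`. [cite: AdamczewskiBellDelaygue2019, Def. 3.8 (k = 1)] -/
def HasLucasProperty (a : (Fin d → ℕ) → ℕ) (p : ℕ) : Prop :=
  ∀ v m : Fin d → ℕ, (∀ i, v i < p) → a (v + p • m) ≡ a v * a m [MOD p]

/-- «`Δ_{e,f}(𝐱) ≥ 1` for all `𝐱 ∈ 𝒟_{e,f}`» at the points `𝐱 = 𝐯/p`: if some top form `(𝐮_j+𝐰_j)·𝐯` reaches
`p` (the bottom forms are smaller), then for some `j` the base-`p` addition `𝐮_j·𝐯 + 𝐰_j·𝐯` carries out of the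
units digit. [cite: AdamczewskiBellDelaygue2019, Prop. 8.7 (hypothesis)] -/
def CarryHyp (u w : Fin r → Fin d → ℕ) (p : ℕ) : Prop :=
  ∀ v : Fin d → ℕ, (∀ i, v i < p) → (∃ j, p ≤ dot (u j) v + dot (w j) v) →
    ∃ j, p ≤ dot (u j) v % p + dot (w j) v % p

/-- «`(1,…,1) ∈ 𝒩`» at the points `𝐯/p`: if the digit sum `|𝐯|` reaches `p`, some `𝐮_j·𝐯 + 𝐰_j·𝐯` carries out
of the units digit. [cite: AdamczewskiBellDelaygue2019, Prop. 7.4 (the set `𝒩`)] -/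
def SumCarryHyp (u w : Fin r → Fin d → ℕ) (p : ℕ) : Prop :=
  ∀ v : Fin d → ℕ, (∀ i, v i < p) → p ≤ ∑ i, v i → ∃ j, p ≤ dot (u j) v % p + dot (w j) v % p

/-- The specialisation `x_i ↦ b_i x`: `spec b a N = Σ_{|𝐧| = N} 𝐛^𝐧 a(𝐧)` is the `N`-th coefficient of
`F(b_1 x, …, b_d x)` for `F = Σ a(𝐧)𝐱^𝐧`. [cite: AdamczewskiBellDelaygue2019, Prop. 7.4, §8.3.1] -/
def spec (b : Fin d → ℤ) (a : (Fin d → ℕ) → ℕ) (N : ℕ) : ℤ :=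
  ∑ n ∈ Finset.Nat.antidiagonalTuple d N, (∏ i, b i ^ n i) * (a n : ℤ)

section Lucas

variable {p : ℕ} [hp : Fact p.Prime]

/-! ## Two facts about one binomial coefficient modulo `p` -/

/-- Lucas' theorem, one digit, for `C(a+b, a)` with `a = a₀ + p a₁`, `b = b₀ + p b₁` and NO carry in the units
digit (`a₀ + b₀ < p`): `C(a+b, a) ≡ C(a₁+b₁, a₁) C(a₀+b₀, a₀)`.
[cite: AdamczewskiBellDelaygue2019, §1 («a classical theorem of Lucas [37]»)] -/
theorem cast_choose_add_of_lt (a₀ b₀ a₁ b₁ : ℕ) (h : a₀ + b₀ < p) :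
    (((a₀ + p * a₁ + (b₀ + p * b₁)).choose (a₀ + p * a₁) : ℕ) : ZMod p)
      = (((a₁ + b₁).choose a₁ : ℕ) : ZMod p) * (((a₀ + b₀).choose a₀ : ℕ) : ZMod p) := by
  have e1 : a₀ + p * a₁ + (b₀ + p * b₁) = (a₁ + b₁) * p + (a₀ + b₀) := by ring
  have e2 : a₀ + p * a₁ = a₁ * p + a₀ := by ring
  rw [e1, e2]
  exact AperyLucasCongruences.cast_choose_digit (a₁ + b₁) (a₀ + b₀) a₁ a₀ h (by omega)

/-- A carry out of the units digit in the base-`p` addition `a + b` kills `C(a+b, a)` modulo `p` (the first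
digit of Lucas' product is `C((a+b) mod p, a mod p)` with `(a+b) mod p < a mod p`).
[cite: AdamczewskiBellDelaygue2019, Prop. 7.4 (proof: «`v_p(Q(𝐚)) ≥ 1`»)] -/
theorem cast_choose_eq_zero_of_carry (a b : ℕ) (h : p ≤ a % p + b % p) :
    (((a + b).choose a : ℕ) : ZMod p) = 0 := by
  have hl := Choose.choose_modEq_choose_mod_mul_choose_div_nat (n := a + b) (k := a) (p := p)
  have ha := Nat.mod_lt a hp.out.pos
  have hb := Nat.mod_lt b hp.out.pos
  have hlt : (a + b) % p < a % p := by
    have e : (a + b) % p = a % p + b % p - p := by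
      rw [Nat.add_mod, Nat.mod_eq_sub_mod h, Nat.mod_eq_of_lt (by omega)]
    omega
  rw [Nat.choose_eq_zero_of_lt hlt, zero_mul] at hl
  rw [(ZMod.natCast_eq_natCast_iff _ _ _).mpr hl, Nat.cast_zero]

/-! ## Prop. 8.7 for binomial type: the `p`-Lucas property of `Q` -/

/-- **[AdamczewskiBellDelaygue2019, Prop. 8.7] / [Delaygue2018, Thm 3, first case], binomial type.**  If every
digit vector at which some top form reaches `p` produces a carry, then `Q(𝐯 + p𝐦) ≡ Q(𝐯) Q(𝐦) (mod p)` for all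
digit vectors `𝐯` and all `𝐦`. [cite: AdamczewskiBellDelaygue2019, Prop. 8.7] -/
theorem hasLucasProperty_binomProd (u w : Fin r → Fin d → ℕ) (hc : CarryHyp u w p) :
    HasLucasProperty (binomProd u w) p := by
  intro v m hv
  rw [← ZMod.natCast_eq_natCast_iff]
  simp only [binomProd, Nat.cast_prod, Nat.cast_mul]
  by_cases hsmall : ∀ j, dot (u j) v + dot (w j) v < p
  · rw [← prod_mul_distrib]
    refine prod_congr rfl fun j _ => ?_
    rw [dot_add, dot_add, dot_smul, dot_smul,
      mul_comm ((((dot (u j) v + dot (w j) v).choose (dot (u j) v) : ℕ) : ZMod p))]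
    exact cast_choose_add_of_lt _ _ _ _ (hsmall j)
  · push Not at hsmall
    obtain ⟨j, hj⟩ := hc v hv hsmall
    have h0 : ((((dot (u j) v + dot (w j) v).choose (dot (u j) v) : ℕ) : ZMod p)) = 0 :=
      cast_choose_eq_zero_of_carry _ _ hj
    have h1 : ((((dot (u j) (v + p • m) + dot (w j) (v + p • m)).choose (dot (u j) (v + p • m)) : ℕ) :
        ZMod p)) = 0 := by
      apply cast_choose_eq_zero_of_carry
      rw [dot_add, dot_smul, dot_add, dot_smul, Nat.add_mul_mod_self_left, Nat.add_mul_mod_self_left]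
      exact hj
    rw [prod_eq_zero (mem_univ j) h1, prod_eq_zero (mem_univ j) h0, zero_mul]

/-! ## Prop. 7.4 (specialisation `x_i ↦ b_i x`) -/

/-- Digit decomposition of a multi-index: `𝐧 = (𝐧 mod p) + p (𝐧 div p)`. [folklore] -/
private theorem decomp_eq (p : ℕ) (n : Fin d → ℕ) :
    (fun k => n k % p) + p • (fun k => n k / p) = n := by
  funext k
  simp only [Pi.add_apply, Pi.smul_apply, smul_eq_mul]
  exact Nat.mod_add_div (n k) p

/-- `|𝐧| = |𝐧 mod p| + p |𝐧 div p|`. [folklore] -/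
private theorem sum_decomp (p : ℕ) (n : Fin d → ℕ) :
    ∑ k, n k = ∑ k, n k % p + p * ∑ k, n k / p := by
  rw [mul_sum, ← sum_add_distrib]
  exact sum_congr rfl fun k _ => (Nat.mod_add_div (n k) p).symm

/-- **[AdamczewskiBellDelaygue2019, Prop. 7.4] with `𝐧 = (1,…,1)`.**  Let `a` have the `p`-Lucas property and
vanish mod `p` at every digit vector of digit sum `≥ p` (this is what `(1,…,1) ∈ 𝒩` provides), and let
`b ∈ ℤ^d`.  Then the specialised sequence `s(N) = Σ_{|𝐧|=N} 𝐛^𝐧 a(𝐧)` satisfies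
`s(n₀ + pN) ≡ s(n₀) s(N) (mod p)` for `0 ≤ n₀ < p` («the terms with `𝐧·𝐚 ≥ p` vanish» and `b_i^p ≡ b_i`).
[cite: AdamczewskiBellDelaygue2019, Prop. 7.4 (proof)] -/
theorem spec_modEq_mul (b : Fin d → ℤ) (a : (Fin d → ℕ) → ℕ) (hL : HasLucasProperty a p)
    (hvan : ∀ v : Fin d → ℕ, (∀ i, v i < p) → p ≤ ∑ i, v i → ((a v : ℕ) : ZMod p) = 0)
    (n₀ N : ℕ) (hn₀ : n₀ < p) :
    spec b a (n₀ + p * N) ≡ spec b a n₀ * spec b a N [ZMOD p] := by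
  have hp0 : 0 < p := hp.out.pos
  rw [← ZMod.intCast_eq_intCast_iff]
  simp only [spec, Int.cast_sum, Int.cast_mul, Int.cast_prod, Int.cast_pow, Int.cast_natCast]
  set T := Finset.Nat.antidiagonalTuple d (n₀ + p * N) with hT
  set A0 := Finset.Nat.antidiagonalTuple d n₀ with hA0
  set A1 := Finset.Nat.antidiagonalTuple d N with hA1
  -- the summand, in `ZMod p`
  set f : (Fin d → ℕ) → ZMod p := fun n => (∏ i, (b i : ZMod p) ^ n i) * ((a n : ℕ) : ZMod p) with hf
  -- Lucas factorisation of one term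
  have hterm : ∀ v m : Fin d → ℕ, (∀ i, v i < p) → f (v + p • m) = f v * f m := by
    intro v m hv
    have hLz : ((a (v + p • m) : ℕ) : ZMod p) = ((a v : ℕ) : ZMod p) * ((a m : ℕ) : ZMod p) := by
      rw [← Nat.cast_mul, ZMod.natCast_eq_natCast_iff]
      exact hL v m hv
    have hbz : (∏ i, (b i : ZMod p) ^ (v + p • m) i) = (∏ i, (b i : ZMod p) ^ v i) * ∏ i, (b i : ZMod p) ^ m i := by
      rw [← prod_mul_distrib]
      refine prod_congr rfl fun i _ => ?_
      simp only [Pi.add_apply, Pi.smul_apply, smul_eq_mul]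
      rw [pow_add, pow_mul, ZMod.pow_card]
    simp only [hf, hLz, hbz]
    ring
  -- terms whose digit vector has digit sum `≠ n₀` vanish
  have hzero : ∀ n ∈ T, (∑ k, n k % p) ≠ n₀ → f n = 0 := by
    intro n hn hne
    have hsum : ∑ k, n k = n₀ + p * N := Finset.Nat.mem_antidiagonalTuple.mp hn
    have hv : ∀ i, (fun k => n k % p) i < p := fun i => Nat.mod_lt _ hp0
    have hge : p ≤ ∑ k, n k % p := by
      by_contra hlt
      push Not at hlt
      apply hne
      have h1 : (∑ k, n k) % p = (∑ k, n k % p) % p := by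
        rw [sum_decomp p n, Nat.add_mul_mod_self_left]
      rw [hsum, Nat.add_mul_mod_self_left, Nat.mod_eq_of_lt hn₀, Nat.mod_eq_of_lt hlt] at h1
      exact h1.symm
    rw [← decomp_eq p n, hterm _ _ hv]
    simp only [hf, hvan _ hv hge, mul_zero, zero_mul]
  rw [← sum_filter_of_ne fun n hn hne => by_contra fun h => hne (hzero n hn h)]
  -- the surviving terms are in bijection with `A0 × A1`
  rw [sum_mul_sum, ← sum_product']
  symm
  refine sum_nbij' (fun x => x.1 + p • x.2) (fun n => (fun k => n k % p, fun k => n k / p)) ?_ ?_ ?_ ?_ ?_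
  · rintro ⟨v, m⟩ hx
    rw [mem_product] at hx
    obtain ⟨hv, hm⟩ := hx
    rw [hA0, Finset.Nat.mem_antidiagonalTuple] at hv
    rw [hA1, Finset.Nat.mem_antidiagonalTuple] at hm
    have hvlt : ∀ i, v i < p := fun i =>
      lt_of_le_of_lt ((single_le_sum (fun j _ => Nat.zero_le (v j)) (mem_univ i)).trans hv.le) hn₀
    rw [mem_filter, hT, Finset.Nat.mem_antidiagonalTuple]
    simp only [Pi.add_apply, Pi.smul_apply, smul_eq_mul]
    refine ⟨?_, ?_⟩
    · rw [sum_add_distrib, ← mul_sum, hv, hm]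
    · rw [← hv]
      exact sum_congr rfl fun i _ => by rw [Nat.add_mul_mod_self_left, Nat.mod_eq_of_lt (hvlt i)]
  · intro n hn
    rw [mem_filter] at hn
    obtain ⟨hnT, hn0⟩ := hn
    rw [hT, Finset.Nat.mem_antidiagonalTuple] at hnT
    rw [mem_product, hA0, hA1, Finset.Nat.mem_antidiagonalTuple, Finset.Nat.mem_antidiagonalTuple]
    refine ⟨hn0, ?_⟩
    have h := sum_decomp p n
    rw [hnT, hn0] at h
    have h' : p * N = p * ∑ k, n k / p := by omega
    exact (Nat.eq_of_mul_eq_mul_left hp0 h').symm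
  · rintro ⟨v, m⟩ hx
    rw [mem_product] at hx
    obtain ⟨hv, -⟩ := hx
    rw [hA0, Finset.Nat.mem_antidiagonalTuple] at hv
    have hvlt : ∀ i, v i < p := fun i =>
      lt_of_le_of_lt ((single_le_sum (fun j _ => Nat.zero_le (v j)) (mem_univ i)).trans hv.le) hn₀
    refine Prod.ext ?_ ?_
    · funext k
      simp only [Pi.add_apply, Pi.smul_apply, smul_eq_mul]
      rw [Nat.add_mul_mod_self_left, Nat.mod_eq_of_lt (hvlt k)]
    · funext k
      simp only [Pi.add_apply, Pi.smul_apply, smul_eq_mul]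
      rw [Nat.add_mul_div_left _ _ hp0, Nat.div_eq_of_lt (hvlt k), zero_add]
  · intro n _
    exact decomp_eq p n
  · rintro ⟨v, m⟩ hx
    rw [mem_product] at hx
    obtain ⟨hv, -⟩ := hx
    rw [hA0, Finset.Nat.mem_antidiagonalTuple] at hv
    have hvlt : ∀ i, v i < p := fun i =>
      lt_of_le_of_lt ((single_le_sum (fun j _ => Nat.zero_le (v j)) (mem_univ i)).trans hv.le) hn₀
    exact (hterm v m hvlt).symm

/-- **Props. 8.7 + 7.4 combined, binomial type**: under the two carry hypotheses at `p`, the specialised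
sequence `s(N) = Σ_{|𝐧|=N} 𝐛^𝐧 ∏_j C((𝐮_j+𝐰_j)·𝐧, 𝐮_j·𝐧)` satisfies `s(n₀ + pN) ≡ s(n₀) s(N) (mod p)` for
`n₀ < p` (the mechanism behind the §8.3.1 table: Apéry, Franel, Domb, Delannoy, …).
[cite: AdamczewskiBellDelaygue2019, Prop. 7.4, §8.3.1] -/
theorem spec_binomProd_modEq_mul (u w : Fin r → Fin d → ℕ) (b : Fin d → ℤ) (hc : CarryHyp u w p)
    (hs : SumCarryHyp u w p) (n₀ N : ℕ) (hn₀ : n₀ < p) :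
    spec b (binomProd u w) (n₀ + p * N) ≡ spec b (binomProd u w) n₀ * spec b (binomProd u w) N [ZMOD p] := by
  refine spec_modEq_mul b _ (hasLucasProperty_binomProd u w hc) (fun v hv hge => ?_) n₀ N hn₀
  obtain ⟨j, hj⟩ := hs v hv hge
  simp only [binomProd, Nat.cast_prod]
  exact prod_eq_zero (mem_univ j) (cast_choose_eq_zero_of_carry _ _ hj)

/-! ## All digits -/

/-- `Σ_{|𝐧| = 0} 𝐛^𝐧 a(𝐧) = a(𝟎)`. [cite: AdamczewskiBellDelaygue2019, Prop. 3.9 (`a(𝟎) = 1` normalisation)] -/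
theorem spec_zero (b : Fin d → ℤ) (a : (Fin d → ℕ) → ℕ) : spec b a 0 = a 0 := by
  simp [spec, Finset.Nat.antidiagonalTuple_zero_right]

/-- `Q(𝟎) = 1`. [cite: AdamczewskiBellDelaygue2019, Prop. 3.9 (`a(𝟎) = 1` normalisation)] -/
theorem binomProd_zero (u w : Fin r → Fin d → ℕ) : binomProd u w 0 = 1 := by
  simp [binomProd, dot]

/-- From the one-digit step `s(n₀ + pN) ≡ s(n₀) s(N)` (`n₀ < p`) and `s(0) = 1` to the product over all
base-`p` digits, `s(n) ≡ ∏_i s(n_i) (mod p)`. [cite: AdamczewskiBellDelaygue2019, Def. 3.8, Rem. 3.3 («itere»)] -/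
theorem modEq_prod_digits_of_step (s : ℕ → ℤ) (h0 : s 0 = 1)
    (hstep : ∀ n₀ N : ℕ, n₀ < p → s (n₀ + p * N) ≡ s n₀ * s N [ZMOD p]) (n : ℕ) :
    s n ≡ ((Nat.digits p n).map s).prod [ZMOD p] := by
  induction n using Nat.strong_induction_on with
  | _ n ih =>
    rcases Nat.eq_zero_or_pos n with hn | hn
    · subst hn
      simp [h0]
    · rw [Nat.digits_def' hp.out.one_lt hn, List.map_cons, List.prod_cons]
      have hst := hstep (n % p) (n / p) (Nat.mod_lt n hp.out.pos)
      rw [Nat.mod_add_div n p] at hst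
      exact hst.trans ((ih (n / p) (Nat.div_lt_self hn hp.out.one_lt)).mul_left _)

/-- **Lucas congruence, all digits, for specialised binomial products**: under the two carry hypotheses at
`p`, `s(n) ≡ ∏_i s(n_i) (mod p)` over the base-`p` digits `n_i` of `n`, where
`s(N) = Σ_{|𝐧|=N} 𝐛^𝐧 ∏_j C((𝐮_j+𝐰_j)·𝐧, 𝐮_j·𝐧)`. [cite: AdamczewskiBellDelaygue2019, Prop. 7.4, Def. 3.8] -/
theorem spec_binomProd_modEq_prod_digits (u w : Fin r → Fin d → ℕ) (b : Fin d → ℤ) (hc : CarryHyp u w p)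
    (hs : SumCarryHyp u w p) (n : ℕ) :
    spec b (binomProd u w) n ≡ ((Nat.digits p n).map (spec b (binomProd u w))).prod [ZMOD p] :=
  modEq_prod_digits_of_step _ (by rw [spec_zero, binomProd_zero, Nat.cast_one])
    (fun n₀ N h => spec_binomProd_modEq_mul u w b hc hs n₀ N h) n

end Lucas

/-! ## The printed (real-variable) hypotheses imply the digit hypotheses at every `p`

[AdamczewskiBellDelaygue2019, Prop. 8.7] quantifies over real points: «`Δ_{e,f}(𝐱) ≥ 1` for all `𝐱` in
`𝒟_{e,f} = {𝐱 ∈ [0,1)^d : 𝐝·𝐱 ≥ 1 for some 𝐝 among the 𝐞_i, 𝐟_j}`», and Prop. 7.4 uses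
`𝒩 = {𝐧 : ∀ 𝐱 ∈ [0,1)^d, 𝐧·𝐱 ≥ 1 ⇒ ξ_1(𝐱) ≥ 1}`.  For binomial type the bottom forms are dominated by the top
forms, so `𝒟_{e,f} = {𝐱 : some (𝐮_j+𝐰_j)·𝐱 ≥ 1}`; evaluating at the rational points `𝐱 = 𝐯/p` gives exactly
`CarryHyp`/`SumCarryHyp` (Legendre: `⌊(a+b)/p⌋ − ⌊a/p⌋ − ⌊b/p⌋` is the units-digit carry). -/

/-- `𝐰·𝐱` at a rational point. [cite: AdamczewskiBellDelaygue2019, §8.3] -/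
def dotQ (w : Fin d → ℕ) (x : Fin d → ℚ) : ℚ := ∑ i, (w i : ℚ) * x i

/-- The Landau function of the binomial-type factorial ratio, `Δ_{e,f}(𝐱) = Σ_i ⌊𝐞_i·𝐱⌋ − Σ_j ⌊𝐟_j·𝐱⌋
= Σ_j (⌊(𝐮_j+𝐰_j)·𝐱⌋ − ⌊𝐮_j·𝐱⌋ − ⌊𝐰_j·𝐱⌋)`. [cite: AdamczewskiBellDelaygue2019, §8.3 (`Δ_{e,f}`)] -/
def landauDelta (u w : Fin r → Fin d → ℕ) (x : Fin d → ℚ) : ℤ :=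
  ∑ j, (⌊dotQ (u j) x + dotQ (w j) x⌋ - ⌊dotQ (u j) x⌋ - ⌊dotQ (w j) x⌋)

/-- The hypothesis of Prop. 8.7 as printed (binomial type): `Δ_{e,f}(𝐱) ≥ 1` for every `𝐱 ∈ [0,1)^d` at which some
top form `(𝐮_j+𝐰_j)·𝐱` is `≥ 1`. [cite: AdamczewskiBellDelaygue2019, Prop. 8.7 (hypothesis)] -/
def LandauHyp (u w : Fin r → Fin d → ℕ) : Prop :=
  ∀ x : Fin d → ℚ, (∀ i, 0 ≤ x i ∧ x i < 1) → (∃ j, 1 ≤ dotQ (u j) x + dotQ (w j) x) → 1 ≤ landauDelta u w x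

/-- `(1,…,1) ∈ 𝒩` as printed: `Δ(𝐱) ≥ 1` for every `𝐱 ∈ [0,1)^d` with `Σ x_i ≥ 1`.
[cite: AdamczewskiBellDelaygue2019, Prop. 7.4 (the set `𝒩`)] -/
def LandauHypSum (u w : Fin r → Fin d → ℕ) : Prop :=
  ∀ x : Fin d → ℚ, (∀ i, 0 ≤ x i ∧ x i < 1) → 1 ≤ ∑ i, x i → 1 ≤ landauDelta u w x

/-- `𝐰·(𝐯/p) = (𝐰·𝐯)/p`. [cite: AdamczewskiBellDelaygue2019, Prop. 7.4 (proof, `ξ(𝐚/p^ℓ)`)] -/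
theorem dotQ_digits (w v : Fin d → ℕ) (p : ℕ) : dotQ w (fun i => (v i : ℚ) / p) = (dot w v : ℚ) / p := by
  simp only [dotQ, dot, Nat.cast_sum, Nat.cast_mul, Finset.sum_div, mul_div_assoc]

/-- Legendre at the first digit: at `𝐱 = 𝐯/p` the Landau function counts the units-digit carries.
[cite: AdamczewskiBellDelaygue2019, Prop. 7.4 (proof: `v_p(Q(𝐚)) = Σ_ℓ ξ(𝐚/p^ℓ)`)] -/
theorem landauDelta_digits (u w : Fin r → Fin d → ℕ) (v : Fin d → ℕ) {p : ℕ} (hp : 0 < p) :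
    landauDelta u w (fun i => (v i : ℚ) / p)
      = ∑ j, (if p ≤ dot (u j) v % p + dot (w j) v % p then (1 : ℤ) else 0) := by
  unfold landauDelta
  refine sum_congr rfl fun j _ => ?_
  rw [dotQ_digits, dotQ_digits, ← add_div, ← Nat.cast_add, Rat.floor_natCast_div_natCast,
    Rat.floor_natCast_div_natCast, Rat.floor_natCast_div_natCast, ← Int.natCast_div, ← Int.natCast_div,
    ← Int.natCast_div, Nat.add_div hp]
  split_ifs <;> push_cast <;> ring

/-- The digit vector `𝐯/p` lies in `[0,1)^d`. [folklore] -/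
private theorem digits_mem_cube {p : ℕ} (v : Fin d → ℕ) (hv : ∀ i, v i < p) (i : Fin d) :
    0 ≤ (v i : ℚ) / p ∧ (v i : ℚ) / p < 1 := by
  have hp : (0 : ℚ) < p := by
    have := hv i
    exact_mod_cast (lt_of_le_of_lt (Nat.zero_le _) this)
  exact ⟨div_nonneg (Nat.cast_nonneg _) hp.le, (div_lt_one hp).mpr (by exact_mod_cast hv i)⟩

/-- A sum of carry indicators is `≥ 1` only if some carry occurs. [folklore] -/
private theorem exists_of_one_le_sum_ite {p : ℕ} (u w : Fin r → Fin d → ℕ) (v : Fin d → ℕ)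
    (h : 1 ≤ ∑ j, (if p ≤ dot (u j) v % p + dot (w j) v % p then (1 : ℤ) else 0)) :
    ∃ j, p ≤ dot (u j) v % p + dot (w j) v % p := by
  by_contra hno
  push Not at hno
  have h0 : ∑ j, (if p ≤ dot (u j) v % p + dot (w j) v % p then (1 : ℤ) else 0) = 0 :=
    sum_eq_zero fun j _ => if_neg (not_le.mpr (hno j))
  omega

/-- **Prop. 8.7's printed hypothesis implies `CarryHyp` at every `p`.**
[cite: AdamczewskiBellDelaygue2019, Prop. 8.7, Prop. 7.4 (proof)] -/
theorem carryHyp_of_landauHyp (u w : Fin r → Fin d → ℕ) (h : LandauHyp u w) {p : ℕ} (hp : 0 < p) :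
    CarryHyp u w p := by
  intro v hv htop
  have hpQ : (0 : ℚ) < p := by exact_mod_cast hp
  obtain ⟨j, hj⟩ := htop
  have h1 := h (fun i => (v i : ℚ) / p) (digits_mem_cube v hv)
    ⟨j, by
      rw [dotQ_digits, dotQ_digits, ← add_div, ← Nat.cast_add, one_le_div hpQ]
      exact_mod_cast hj⟩
  rw [landauDelta_digits u w v hp] at h1
  exact exists_of_one_le_sum_ite u w v h1

/-- **`(1,…,1) ∈ 𝒩` (printed form) implies `SumCarryHyp` at every `p`.**
[cite: AdamczewskiBellDelaygue2019, Prop. 7.4 (proof)] -/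
theorem sumCarryHyp_of_landauHypSum (u w : Fin r → Fin d → ℕ) (h : LandauHypSum u w) {p : ℕ} (hp : 0 < p) :
    SumCarryHyp u w p := by
  intro v hv hsum
  have hpQ : (0 : ℚ) < p := by exact_mod_cast hp
  have h1 := h (fun i => (v i : ℚ) / p) (digits_mem_cube v hv)
    (by
      rw [← Finset.sum_div, one_le_div hpQ]
      exact_mod_cast hsum)
  rw [landauDelta_digits u w v hp] at h1
  exact exists_of_one_le_sum_ite u w v h1

/-- **[AdamczewskiBellDelaygue2019, Prop. 8.7 + Prop. 7.4] with the hypotheses as printed** (binomial type,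
`𝐧 = (1,…,1)`, `b ∈ ℤ^d`): the specialised sequence satisfies the Lucas congruence at EVERY prime.
[cite: AdamczewskiBellDelaygue2019, Prop. 8.7, Prop. 7.4] -/
theorem spec_binomProd_modEq_mul_of_landau (u w : Fin r → Fin d → ℕ) (b : Fin d → ℤ) (hL : LandauHyp u w)
    (hN : LandauHypSum u w) {p : ℕ} [Fact p.Prime] (n₀ N : ℕ) (hn₀ : n₀ < p) :
    spec b (binomProd u w) (n₀ + p * N) ≡ spec b (binomProd u w) n₀ * spec b (binomProd u w) N [ZMOD p] :=
  spec_binomProd_modEq_mul u w b (carryHyp_of_landauHyp u w hL (Nat.Prime.pos Fact.out))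
    (sumCarryHyp_of_landauHypSum u w hN (Nat.Prime.pos Fact.out)) n₀ N hn₀

end Literature.Combinatorics.Enumerative.BinomialProductLucas
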